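import Summits.CriticalPhenomena.CardyFormulaZ2.Theorems.CardySelfRefinementLagHandOffHalfPlaneTwoArmUndockedFrontier
import Summits.CriticalPhenomena.CardyFormulaZ2.Theorems.CardySelfRefinementLagHandOffHalfPlaneTwoArmUndockedArch
import HarnessLib

/-!
# An undocked open arm costs a third arm (the three-arm extraction of the undocked two-arm bound)

Support file for the registered stub `stub_noTouch_undockedThreeArm` of crux
stmt-CriticalPhenomena-10268 (line `hitting-tournament`), towards the undocked half-plane two-arm
bound (X) for critical bond percolation on `ℤ²` (the hypothesis of the landed
`stub_noTouch_undockedThreeArm_of_twoArm`).  The deterministic core of the docking step of the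
multiscale argument (H. Kesten's docking of half-plane arms, here WITHOUT arm separation):

* `stub_undockedTwoArm_threeArms` — in the shell `Sh = {s ≤ dist ≤ S', rows ≥ k}` around a lattice
  point `c` of row `k` (`16 ≤ s`, `4s ≤ S'`), let an open walk `P` and a dual walk `Q` crossing
  closed edges, both of rows `≥ k`, run from distance `≤ s - 8` to distance `≥ S' + 8`, and suppose
  NO vertex of `P` is joined inside `Sh` by an open path to a bottom site of `Sh` (the open arm is
  undocked at this scale).  Then `ω` lies in the disjoint occurrence `U₂ □ D₁` of the undocked
  two-arm event `U₂` of the half-annulus `{s/2 ≤ dist ≤ S'}` (radii `s/2`, `S'`) and the closed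
  dual crossing `D₁` of the annulus `{2s + 1 ≤ dist ≤ S' - 8}`.

Proof.  Let `𝒪_L`, `𝒪_R` be the sites joined inside `Sh` to the bottom sites left, resp. right,
of `c`; `P` avoids both.  Their closed frontiers `Z_L`, `Z_R` (`stub_undockedTwoArm_frontier`)
cross the annulus `[2s, S' - 7]` through closed edges with an end in `𝒪_L`, resp. `𝒪_R`.  If the
part `κ` of `Q` inside `s - 2 < dist < S' + 2` crosses no edge with an end in `𝒪_L`, the edges of
`κ` and of `Z_L` are distinct, and (sub-walks of `P`, `κ`; sub-walk of `Z_L`) are disjoint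
witnesses of `U₂` and `D₁`; likewise with `𝒪_R`, `Z_R`.  Otherwise `κ` crosses an edge with an
end in `𝒪_L` and one with an end in `𝒪_R`, which the arch obstruction
(`stub_undockedTwoArm_arch`) forbids.

References: H. Kesten, Comm. Math. Phys. 109 (1987), Lemma 4 [KestenScalingCMP1987];
G. F. Lawler, O. Schramm, W. Werner, Electron. J. Probab. 7 (2002), Appendix A
[LawlerSchrammWernerEJP2002]; G. Grimmett, *Percolation* (1999), §2.3 (disjoint occurrence),
§11.2 [GrimmettPercolation1999].
-/

noncomputable section

open Set Metric Complex SimpleGraph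
open scoped unitInterval
open Literature.Probability.Percolation Literature.Probability.LatticeModels
open Literature.Probability.Percolation.QuadCrossing

namespace Summit.CriticalPhenomena.CardyFormulaZ2.Cruxes.LagHandOff.HittingTournament

/-- The distance from the centre of a site of the centre's row is the difference of abscissae.
[folklore] -/
theorem dist_meshPoint_of_row_eq {b c₀ : Site 2} (h : b 1 = c₀ 1) :
    dist (meshPoint 1 b) (meshPoint 1 c₀) = |((b 0 : ℤ) : ℝ) - (c₀ 0 : ℝ)| := by
  have : meshPoint 1 b - meshPoint 1 c₀ = (((b 0 : ℤ) : ℝ) - (c₀ 0 : ℝ) : ℝ) := by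
    apply Complex.ext
    · simp
    · simp [h]
  rw [dist_eq_norm, this, Complex.norm_real, Real.norm_eq_abs]

/-- **An undocked open arm costs a third arm.**  See the module docstring: in the shell
`Sh = {s ≤ dist ≤ S', rows ≥ c₀ 1}` (`16 ≤ s`, `4 s ≤ S'`), an open walk `P` and a closed dual walk
`Q` of rows `≥ c₀ 1` from distance `≤ s - 8` to `≥ S' + 8`, with no vertex of `P` joined inside
`Sh` to a bottom site of `Sh`, force the disjoint occurrence of the undocked two-arm event of
radii `(s/2, S')` and of a closed dual crossing of `{2s + 1 ≤ dist ≤ S' - 8}`.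
[cite: KestenScalingCMP1987, Lemma 4] -/
theorem stub_undockedTwoArm_threeArms : ∀ {ω : BondConfig (Site 2)}, ω ⊆ (zdGraph 2).edgeSet →
    ∀ (c₀ : Site 2) {s S' : ℝ}, 16 ≤ s → 4 * s ≤ S' →
    ∀ (Sh : Set (Site 2)), Sh = {v : Site 2 | s ≤ dist (meshPoint 1 v) (meshPoint 1 c₀) ∧
      dist (meshPoint 1 v) (meshPoint 1 c₀) ≤ S' ∧ c₀ 1 ≤ v 1} →
    ∀ {u w : Site 2} (P : (zdGraph 2).Walk u w), (∀ e ∈ P.edges, e ∈ ω) →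
    (∀ z ∈ P.support, c₀ 1 ≤ z 1) →
    dist (meshPoint 1 u) (meshPoint 1 c₀) ≤ s - 8 → S' + 8 ≤ dist (meshPoint 1 w) (meshPoint 1 c₀) →
    (∀ z ∈ P.support, ∀ b ∈ Sh, b 1 = c₀ 1 → ω ∉ openConnIn Sh b z) →
    ∀ {f g : Site 2} (Q : (zdGraph 2).Walk f g), (∀ d ∈ Q.darts, sepEdge d.fst d.snd ∉ ω) →
    (∀ z ∈ Q.support, c₀ 1 ≤ z 1) →
    dist (meshPoint 1 f) (meshPoint 1 c₀) ≤ s - 8 → S' + 8 ≤ dist (meshPoint 1 g) (meshPoint 1 c₀) →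
    ∀ (S₂ T : Set (Site 2)),
    S₂ = {v : Site 2 | s / 2 ≤ dist (meshPoint 1 v) (meshPoint 1 c₀) ∧
      dist (meshPoint 1 v) (meshPoint 1 c₀) ≤ S' ∧ (meshPoint 1 c₀).im ≤ (meshPoint 1 v).im} →
    T = {v : Site 2 | 2 * s + 1 ≤ dist (meshPoint 1 v) (meshPoint 1 c₀) ∧
      dist (meshPoint 1 v) (meshPoint 1 c₀) ≤ S' - 8} →
    ω ∈ {ω : BondConfig (Site 2) | ∃ v w f g : Site 2,
        dist (meshPoint 1 v) (meshPoint 1 c₀) ≤ 2 * (s / 2) ∧ dist (meshPoint 1 f) (meshPoint 1 c₀) ≤ 2 * (s / 2) ∧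
        S' / 2 ≤ dist (meshPoint 1 w) (meshPoint 1 c₀) ∧ S' / 2 ≤ dist (meshPoint 1 g) (meshPoint 1 c₀) ∧
        ω ∈ openConnIn S₂ v w ∧ dualConfig ω ∈ openConnIn S₂ f g} □
      {ω : BondConfig (Site 2) | ∃ f g : Site 2, dist (meshPoint 1 f) (meshPoint 1 c₀) ≤ 2 * s + 2 ∧
        S' - 9 ≤ dist (meshPoint 1 g) (meshPoint 1 c₀) ∧ dualConfig ω ∈ openConnIn T f g} := by
  intro ω hω c₀ s S' hs hS Sh hSh u w P hPω hProw hPu hPw hPdock f g Q hQω hQrow hQf hQg S₂ T hS₂ hT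
  classical
  set c := meshPoint 1 c₀ with hc
  set k : ℤ := c₀ 1 with hk
  have hcim : c.im = k := by rw [hc, meshPoint_im, one_mul]
  -- the one-sided bottom clusters, both avoided by `P`
  set 𝒪L : Set (Site 2) := {z | ∃ b ∈ Sh, b 1 = c₀ 1 ∧ b 0 < c₀ 0 ∧ ω ∈ openConnIn Sh b z} with h𝒪L
  set 𝒪R : Set (Site 2) := {z | ∃ b ∈ Sh, b 1 = c₀ 1 ∧ c₀ 0 < b 0 ∧ ω ∈ openConnIn Sh b z} with h𝒪R
  have hPL : ∀ z ∈ P.support, z ∉ 𝒪L := fun z hz ⟨b, hb, hb1, _, hconn⟩ => hPdock z hz b hb hb1 hconn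
  have hPR : ∀ z ∈ P.support, z ∉ 𝒪R := fun z hz ⟨b, hb, hb1, _, hconn⟩ => hPdock z hz b hb hb1 hconn
  have hLSh : 𝒪L ⊆ Sh := fun z ⟨b, hb, hb1, _, hconn⟩ => hconn.2.1
  have hRSh : 𝒪R ⊆ Sh := fun z ⟨b, hb, hb1, _, hconn⟩ => hconn.2.1
  have hLclosed : ∀ x y : Site 2, x ∈ 𝒪L → y ∈ Sh → s(x, y) ∈ ω → y ∈ 𝒪L := by
    rintro x y ⟨b, hb, hb1, hb0, hconn⟩ hy hxy
    by_cases hne : x = y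
    · subst hne; exact ⟨b, hb, hb1, hb0, hconn⟩
    · exact ⟨b, hb, hb1, hb0, PlanarDuality.openConnIn_trans hconn (openConnIn_of_adj hconn.2.1 hy hxy hne)⟩
  have hRclosed : ∀ x y : Site 2, x ∈ 𝒪R → y ∈ Sh → s(x, y) ∈ ω → y ∈ 𝒪R := by
    rintro x y ⟨b, hb, hb1, hb0, hconn⟩ hy hxy
    by_cases hne : x = y
    · subst hne; exact ⟨b, hb, hb1, hb0, hconn⟩
    · exact ⟨b, hb, hb1, hb0, PlanarDuality.openConnIn_trans hconn (openConnIn_of_adj hconn.2.1 hy hxy hne)⟩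
  have hLbot : ∀ b ∈ Sh, b 1 = c₀ 1 → ((2 : Fin 4) = 2 → b 0 < c₀ 0) → ((2 : Fin 4) = 0 → c₀ 0 < b 0) → b ∈ 𝒪L :=
    fun b hb hb1 h2 _ => ⟨b, hb, hb1, h2 rfl, openConnIn_refl hb⟩
  have hRbot : ∀ b ∈ Sh, b 1 = c₀ 1 → ((0 : Fin 4) = 2 → b 0 < c₀ 0) → ((0 : Fin 4) = 0 → c₀ 0 < b 0) → b ∈ 𝒪R :=
    fun b hb hb1 _ h0 => ⟨b, hb, hb1, h0 rfl, openConnIn_refl hb⟩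
  -- the two frontiers, crossing `[2s, S' - 7]`
  have hs0 : 0 < s := by linarith
  have hPu' : dist (meshPoint 1 u) c ≤ 2 * s := by rw [hc]; linarith
  have hPw' : S' - 7 ≤ dist (meshPoint 1 w) c := by rw [hc]; linarith
  obtain ⟨fL, gL, ZL, hfL, hgL, hZLsupp, hZL⟩ := stub_undockedTwoArm_frontier hω c₀ (s := s) (S' := S')
    (a₁ := 2 * s) (b₁ := S' - 7) hs0 (by linarith) (by linarith) (by linarith) Sh 𝒪L hSh hLSh hLclosed 2
    (Or.inr rfl) hLbot P hPω hProw hPL hPu' hPw'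
  obtain ⟨fR, gR, ZR, hfR, hgR, hZRsupp, hZR⟩ := stub_undockedTwoArm_frontier hω c₀ (s := s) (S' := S')
    (a₁ := 2 * s) (b₁ := S' - 7) hs0 (by linarith) (by linarith) (by linarith) Sh 𝒪R hSh hRSh hRclosed 0
    (Or.inl rfl) hRbot P hPω hProw hPR hPu' hPw'
  -- the part of `Q` in the shell
  obtain ⟨xQ, yQ, κ, hxQ, hyQ, hκsupp, hκedges, hκdist⟩ :=
    stub_undockedThreeArm_subwalk (δ := 1) c (show s - 1 < S' + 1 by linarith) Q
      (show dist (meshPoint 1 f) c ≤ s - 1 by rw [hc]; linarith) (show S' + 1 ≤ dist (meshPoint 1 g) c by rw [hc]; linarith)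
  have hκclosed : ∀ d ∈ κ.darts, sepEdge d.fst d.snd ∉ ω := fun d hd => by
    obtain ⟨d₀, hd₀, he⟩ := exists_dart_sepEdge_eq Q κ hκedges d hd
    rw [he]; exact hQω d₀ hd₀
  have hκrow : ∀ z ∈ κ.support, c₀ 1 ≤ z 1 := fun z hz => hQrow z (hκsupp z hz)
  -- witnesses of the two-arm event: sub-walks of `P` and of `κ` crossing `[s, S'/2]`
  have hsS : s < S' / 2 := by linarith
  obtain ⟨v₁, w₁, P', hv₁, hw₁, hP'supp, hP'edges, hP'dist⟩ :=
    stub_undockedThreeArm_subwalk (δ := 1) c hsS P (show dist (meshPoint 1 u) c ≤ s by rw [hc]; linarith)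
      (show S' / 2 ≤ dist (meshPoint 1 w) c by rw [hc]; linarith)
  obtain ⟨f₁, g₁, κ', hf₁, hg₁, hκ'supp, hκ'edges, hκ'dist⟩ :=
    stub_undockedThreeArm_subwalk (δ := 1) c hsS κ (by linarith) (by linarith)
  have hP'S₂ : ∀ z ∈ P'.support, z ∈ S₂ := fun z hz => by
    obtain ⟨h1, h2⟩ := hP'dist z hz
    rw [abs_one] at h1 h2
    rw [hS₂]
    refine ⟨by linarith, by linarith, ?_⟩
    rw [hcim, meshPoint_im, one_mul]
    exact_mod_cast hProw z (hP'supp z hz)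
  have hκ'S₂ : ∀ z ∈ κ'.support, z ∈ S₂ := fun z hz => by
    obtain ⟨h1, h2⟩ := hκ'dist z hz
    rw [abs_one] at h1 h2
    rw [hS₂]
    refine ⟨by linarith, by linarith, ?_⟩
    rw [hcim, meshPoint_im, one_mul]
    exact_mod_cast hκrow z (hκ'supp z hz)
  have hκ'closed : ∀ d ∈ κ'.darts, ∃ d₀ ∈ κ.darts, sepEdge d.fst d.snd = sepEdge d₀.fst d₀.snd :=
    exists_dart_sepEdge_eq κ κ' hκ'edges
  -- the two-arm cylinder
  set K : Set (Sym2 (Site 2)) := {e | e ∈ P'.edges ∨ ∃ d ∈ κ'.darts, e = sepEdge d.fst d.snd} with hKdef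
  have hKU : ∀ ω' ∈ localCylinder K ω, ω' ∈ {ω : BondConfig (Site 2) | ∃ v w f g : Site 2,
      dist (meshPoint 1 v) (meshPoint 1 c₀) ≤ 2 * (s / 2) ∧ dist (meshPoint 1 f) (meshPoint 1 c₀) ≤ 2 * (s / 2) ∧
      S' / 2 ≤ dist (meshPoint 1 w) (meshPoint 1 c₀) ∧ S' / 2 ≤ dist (meshPoint 1 g) (meshPoint 1 c₀) ∧
      ω ∈ openConnIn S₂ v w ∧ dualConfig ω ∈ openConnIn S₂ f g} := by
    intro ω' hω'
    refine ⟨v₁, w₁, f₁, g₁, by linarith, by linarith, hw₁, hg₁, ?_, ?_⟩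
    · exact mem_openConnIn_of_walk P' hP'S₂ fun e he => (hω' e (Or.inl he)).2 (hPω e (hP'edges e he))
    · refine Z2HalfPlane.dualConfig_mem_openConnIn_of_walk κ' hκ'S₂ fun d hd h => ?_
      obtain ⟨d₀, hd₀, he⟩ := hκ'closed d hd
      exact hκclosed d₀ hd₀ (he ▸ (hω' _ (Or.inr ⟨d, hd, rfl⟩)).1 h)
  -- the dual-crossing cylinder of a frontier
  have hD : ∀ {f₀ g₀ : Site 2} (Z : (zdGraph 2).Walk f₀ g₀), dist (meshPoint 1 f₀) c ≤ 2 * s + 2 →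
      S' - 7 - 2 ≤ dist (meshPoint 1 g₀) c → (∀ d ∈ Z.darts, sepEdge d.fst d.snd ∉ ω) →
      ∃ L : Set (Sym2 (Site 2)), (∀ e ∈ L, ∃ d ∈ Z.darts, e = sepEdge d.fst d.snd) ∧
        ∀ ω' ∈ localCylinder L ω, ω' ∈ {ω : BondConfig (Site 2) | ∃ f g : Site 2,
          dist (meshPoint 1 f) (meshPoint 1 c₀) ≤ 2 * s + 2 ∧ S' - 9 ≤ dist (meshPoint 1 g) (meshPoint 1 c₀) ∧
          dualConfig ω ∈ openConnIn T f g} := by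
    intro f₀ g₀ Z hf₀ hg₀ hZ
    obtain ⟨f₂, g₂, Z', hf₂, hg₂, hZ'supp, hZ'edges, hZ'dist⟩ :=
      stub_undockedThreeArm_subwalk (δ := 1) c (show 2 * s + 2 < S' - 9 by linarith) Z hf₀ (by linarith)
    have hZ'closed := exists_dart_sepEdge_eq Z Z' hZ'edges
    refine ⟨{e | ∃ d ∈ Z'.darts, e = sepEdge d.fst d.snd}, ?_, fun ω' hω' => ⟨f₂, g₂, hf₂, hg₂, ?_⟩⟩
    · rintro e ⟨d, hd, rfl⟩
      obtain ⟨d₀, hd₀, he⟩ := hZ'closed d hd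
      exact ⟨d₀, hd₀, he⟩
    · refine Z2HalfPlane.dualConfig_mem_openConnIn_of_walk Z' (fun z hz => ?_) fun d hd h => ?_
      · obtain ⟨h1, h2⟩ := hZ'dist z hz
        rw [abs_one] at h1 h2
        rw [hT]
        exact ⟨by linarith, by linarith⟩
      · obtain ⟨d₀, hd₀, he⟩ := hZ'closed d hd
        exact hZ d₀ hd₀ (he ▸ (hω' _ ⟨d, hd, rfl⟩).1 h)
  -- the witnesses are disjoint when `κ` crosses no edge with an end in the cluster
  have hclean : ∀ {𝒞 : Set (Site 2)} {f₀ g₀ : Site 2} (Z : (zdGraph 2).Walk f₀ g₀),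
      (∀ d ∈ Z.darts, sepEdge d.fst d.snd ∉ ω ∧ ∃ z ∈ sepEdge d.fst d.snd, z ∈ 𝒞) →
      (∀ d ∈ κ.darts, ∀ z ∈ sepEdge d.fst d.snd, z ∉ 𝒞) →
      ∀ L : Set (Sym2 (Site 2)), (∀ e ∈ L, ∃ d ∈ Z.darts, e = sepEdge d.fst d.snd) → Disjoint K L := by
    intro 𝒞 f₀ g₀ Z hZ hκ𝒞 L hL
    rw [Set.disjoint_left]
    rintro e (he | ⟨d, hd, rfl⟩) heL
    · obtain ⟨d₀, hd₀, rfl⟩ := hL e heL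
      exact (hZ d₀ hd₀).1 (hPω _ (hP'edges _ he))
    · obtain ⟨d₁, hd₁, he⟩ := hL _ heL
      obtain ⟨d₀, hd₀, he₀⟩ := hκ'closed d hd
      obtain ⟨z, hz, hz𝒞⟩ := (hZ d₁ hd₁).2
      rw [← he, he₀] at hz
      exact hκ𝒞 d₀ hd₀ z hz hz𝒞
  -- trichotomy
  by_cases hcleanL : ∀ d ∈ κ.darts, ∀ z ∈ sepEdge d.fst d.snd, z ∉ 𝒪L
  · obtain ⟨L, hL, hLD⟩ := hD ZL hfL hgL fun d hd => (hZL d hd).1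
    exact ⟨K, L, hclean ZL hZL hcleanL L hL, hKU, hLD⟩
  by_cases hcleanR : ∀ d ∈ κ.darts, ∀ z ∈ sepEdge d.fst d.snd, z ∉ 𝒪R
  · obtain ⟨L, hL, hLD⟩ := hD ZR hfR hgR fun d hd => (hZR d hd).1
    exact ⟨K, L, hclean ZR hZR hcleanR L hL, hKU, hLD⟩
  -- `κ` touches both clusters: the arch obstruction
  exfalso
  push Not at hcleanL hcleanR
  obtain ⟨dL, hdL, zL, hzL, hzL𝒪⟩ := hcleanL
  obtain ⟨dR, hdR, zR, hzR, hzR𝒪⟩ := hcleanR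
  obtain ⟨bL, hbLSh, hbL1, hbL0, hconnL⟩ := hzL𝒪
  obtain ⟨bR, hbRSh, hbR1, hbR0, hconnR⟩ := hzR𝒪
  obtain ⟨πL, hπLSh, hπLω⟩ := exists_walk_of_mem_openConnIn hω hconnL
  obtain ⟨πR, hπRSh, hπRω⟩ := exists_walk_of_mem_openConnIn hω hconnR
  have hπL𝒪 : ∀ v ∈ πL.support, v ∈ 𝒪L := fun v hv =>
    ⟨bL, hbLSh, hbL1, hbL0, mem_openConnIn_of_mem_support πL hπLSh hπLω hv⟩
  have hπR𝒪 : ∀ v ∈ πR.support, v ∈ 𝒪R := fun v hv =>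
    ⟨bR, hbRSh, hbR1, hbR0, mem_openConnIn_of_mem_support πR hπRSh hπRω hv⟩
  obtain ⟨ρ, hρsupp, hρdarts⟩ := exists_subwalk_between κ (κ.dart_fst_mem_support_of_mem_darts hdL)
    (κ.dart_fst_mem_support_of_mem_darts hdR)
  have hbLdist : dist (meshPoint 1 bL) c = ((c₀ 0 - bL 0 : ℤ) : ℝ) := by
    have hlt : ((bL 0 : ℤ) : ℝ) < c₀ 0 := by exact_mod_cast hbL0
    rw [hc, dist_meshPoint_of_row_eq hbL1, abs_of_neg (by linarith)]
    push_cast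
    ring
  have hbRdist : dist (meshPoint 1 bR) c = ((bR 0 - c₀ 0 : ℤ) : ℝ) := by
    have hlt : ((c₀ 0 : ℤ) : ℝ) < bR 0 := by exact_mod_cast hbR0
    rw [hc, dist_meshPoint_of_row_eq hbR1, abs_of_pos (by linarith)]
    push_cast
    ring
  have hbLSh' := hbLSh
  have hbRSh' := hbRSh
  rw [hSh] at hbLSh' hbRSh'
  refine stub_undockedTwoArm_arch c₀ (a₀ := s - 8) (b₀ := S' + 8) (by linarith) (by linarith) P hPω hProw
    (by rw [← hc]; linarith) (by rw [← hc]; linarith) πL πR (fun v hv => ?_) (fun v hv => ?_) hbL1 ?_ ?_ hbR1 ?_ ?_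
    dL.adj dR.adj (hκclosed dL hdL) (hκclosed dR hdR) hzL hzR (hκrow _ (κ.dart_snd_mem_support_of_mem_darts hdL))
    (hκrow _ (κ.dart_snd_mem_support_of_mem_darts hdR)) ρ (fun d hd => ?_) (fun x hx => ?_)
  · have hvSh := hπLSh v hv
    rw [hSh] at hvSh
    exact ⟨fun hvP => hPL v hvP (hπL𝒪 v hv), hvSh.2.2, by rw [← hc]; linarith [hvSh.1], by rw [← hc]; linarith [hvSh.2.1]⟩
  · have hvSh := hπRSh v hv
    rw [hSh] at hvSh
    exact ⟨fun hvP => hPR v hvP (hπR𝒪 v hv), hvSh.2.2, by rw [← hc]; linarith [hvSh.1], by rw [← hc]; linarith [hvSh.2.1]⟩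
  · rw [← hbLdist]; linarith [hbLSh'.1]
  · rw [← hbLdist]; linarith [hbLSh'.2.1]
  · rw [← hbRdist]; linarith [hbRSh'.1]
  · rw [← hbRdist]; linarith [hbRSh'.2.1]
  · rcases hρdarts d hd with h | h
    · exact hκclosed d h
    · have := hκclosed d.symm h
      rwa [show d.symm.fst = d.snd from rfl, show d.symm.snd = d.fst from rfl, sepEdge_comm] at this
  · have hx' := hκdist x (hρsupp x hx)
    rw [abs_one] at hx'
    exact ⟨hκrow x (hρsupp x hx), by rw [← hc]; linarith [hx'.1], by rw [← hc]; linarith [hx'.2]⟩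

end Summit.CriticalPhenomena.CardyFormulaZ2.Cruxes.LagHandOff.HittingTournament
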